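import Mathlib

/-!
# Local convergence on good intervals + tightness at finitely many bad points ⇒ global convergence
# (helper for `DensityIntegration`, item stmt-CriticalPhenomena-14890, route CardyBoundaryCoulombGas)

The bookkeeping step of the density integration. Along the image `[u_c, u_d] ⊆ ℝ = ∂ℍ` of a boundary
arc, the lattice mark masses converge to `∫ g` on every compact interval avoiding a finite set of
*bad* points (the two end points and the images of the polygon's corners, where the engine crux is
silent), and the total mass near the bad points is uniformly small (RSW tightness). Then the total
mass converges to `∫_{(u_c,u_d)} g`. Pure measure theory / real analysis: the good part of the
interval is a finite disjoint union of intervals between consecutive bad points, and the integral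
of `|g|` over the `r`-neighbourhood of the bad points tends to `0` with `r`.
-/

noncomputable section

open Set Filter Topology MeasureTheory Finset

namespace Summit.CriticalPhenomena.CardyFormulaZ2.Theorems

/-! ### Consecutive bad points -/

/-- Every point of `[u_c, u_d]` is either within `r` of a bad point or lies in the shrunk interval
`[x + r, y − r]` between two CONSECUTIVE bad points `x < y` (`u_c, u_d` themselves bad). [folklore] -/
theorem exists_near_or_between_consecutive (bad : Finset ℝ) {uc ud r t : ℝ} (huc : uc ∈ bad)
    (hud : ud ∈ bad) (hr : 0 < r) (ht : t ∈ Icc uc ud) :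
    (∃ q ∈ bad, |t - q| < r) ∨ ∃ x ∈ bad, ∃ y ∈ bad, x < y ∧ (∀ q ∈ bad, ¬(x < q ∧ q < y)) ∧
      x + r ≤ t ∧ t ≤ y - r := by
  classical
  set L := bad.filter (· ≤ t) with hL
  set U := bad.filter (t ≤ ·) with hU
  have hLne : L.Nonempty := ⟨uc, by simp [hL, huc, ht.1]⟩
  have hUne : U.Nonempty := ⟨ud, by simp [hU, hud, ht.2]⟩
  set x := L.max' hLne
  set y := U.min' hUne
  have hxL : x ∈ L := L.max'_mem hLne
  have hyU : y ∈ U := U.min'_mem hUne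
  have hxbad : x ∈ bad := (Finset.mem_filter.1 hxL).1
  have hybad : y ∈ bad := (Finset.mem_filter.1 hyU).1
  have hxt : x ≤ t := (Finset.mem_filter.1 hxL).2
  have hty : t ≤ y := (Finset.mem_filter.1 hyU).2
  by_cases hnear : |t - x| < r ∨ |t - y| < r
  · rcases hnear with h | h
    · exact Or.inl ⟨x, hxbad, h⟩
    · exact Or.inl ⟨y, hybad, h⟩
  push Not at hnear
  obtain ⟨h1, h2⟩ := hnear
  rw [abs_of_nonneg (sub_nonneg.2 hxt)] at h1
  rw [abs_sub_comm, abs_of_nonneg (sub_nonneg.2 hty)] at h2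
  refine Or.inr ⟨x, hxbad, y, hybad, by linarith, ?_, by linarith, by linarith⟩
  · intro q hq ⟨hxq, hqy⟩
    rcases le_total q t with hqt | htq
    · have : q ∈ L := Finset.mem_filter.2 ⟨hq, hqt⟩
      exact absurd (L.le_max' q this) (not_le.2 hxq)
    · have : q ∈ U := Finset.mem_filter.2 ⟨hq, htq⟩
      exact absurd (U.min'_le q this) (not_le.2 hqy)

/-- Points of the shrunk interval between consecutive bad points are at distance `≥ r` from every
bad point. [folklore] -/
theorem le_abs_sub_of_mem_Icc_consecutive {bad : Finset ℝ} {x y r t q : ℝ}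
    (hcons : ∀ q ∈ bad, ¬(x < q ∧ q < y)) (ht : t ∈ Icc (x + r) (y - r)) (hq : q ∈ bad) :
    r ≤ |t - q| := by
  have h := hcons q hq
  by_cases hxq : x < q
  · have hyq : y ≤ q := not_lt.1 fun h' ↦ h ⟨hxq, h'⟩
    exact le_abs.2 (Or.inr (by linarith [ht.2]))
  · push Not at hxq
    exact le_abs.2 (Or.inl (by linarith [ht.1]))

/-- The shrunk intervals of two distinct consecutive pairs of bad points are disjoint (`r > 0`). [folklore] -/
theorem disjoint_Icc_consecutive {bad : Finset ℝ} {x y x' y' r : ℝ} (hr : 0 < r)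
    (hx : x ∈ bad) (hy : y ∈ bad) (hx' : x' ∈ bad) (hy' : y' ∈ bad)
    (hcons : ∀ q ∈ bad, ¬(x < q ∧ q < y)) (hcons' : ∀ q ∈ bad, ¬(x' < q ∧ q < y'))
    (hne : (x, y) ≠ (x', y')) :
    Disjoint (Icc (x + r) (y - r)) (Icc (x' + r) (y' - r)) := by
  rw [Set.disjoint_iff]
  rintro t ⟨ht, ht'⟩
  rcases lt_trichotomy x x' with hlt | heq | hgt
  · -- `y ≤ x'`
    have hyx' : y ≤ x' := not_lt.1 fun h ↦ hcons x' hx' ⟨hlt, h⟩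
    have := ht.2; have := ht'.1; linarith
  · subst heq
    have hyy' : y ≠ y' := fun h ↦ hne (by rw [h])
    rcases lt_or_gt_of_ne hyy' with h | h
    · -- `y` is a bad point strictly between `x` and `y'` unless `y ≤ x`
      by_cases hxy : x < y
      · exact hcons' y hy ⟨hxy, h⟩
      · push Not at hxy
        have := ht.1; have := ht.2; linarith
    · by_cases hxy : x < y'
      · exact hcons y' hy' ⟨hxy, h⟩
      · push Not at hxy
        have := ht'.1; have := ht'.2; linarith
  · have hyx : y' ≤ x := not_lt.1 fun h ↦ hcons' x hx ⟨hgt, h⟩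
    have := ht'.2; have := ht.1; linarith

/-! ### The neighbourhood of the bad points carries little integral -/

/-- The `r`-neighbourhood `{t | ∃ q ∈ bad, |t - q| < r}` of a finite set is a finite union of open
balls, hence measurable. [folklore] -/
theorem measurableSet_near (bad : Finset ℝ) (r : ℝ) :
    MeasurableSet {t : ℝ | ∃ q ∈ bad, |t - q| < r} := by
  have : {t : ℝ | ∃ q ∈ bad, |t - q| < r} = ⋃ q ∈ bad, Metric.ball q r := by
    ext t
    simp [Metric.mem_ball, Real.dist_eq]
  rw [this]
  exact Finset.measurableSet_biUnion _ fun q _ ↦ measurableSet_ball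

/-- For a nonnegative function integrable on `S`, the integral over the part of `S` within `r` of
finitely many points is `≤ ε` for some `r > 0` (the neighbourhoods decrease to a finite, null set). [folklore] -/
theorem exists_setIntegral_near_le (bad : Finset ℝ) {S : Set ℝ} (hS : MeasurableSet S)
    {g : ℝ → ℝ} (hg : IntegrableOn g S) {ε : ℝ} (hε : 0 < ε) :
    ∃ r > 0, ∫ t in S ∩ {t | ∃ q ∈ bad, |t - q| < r}, g t ≤ ε := by
  set s : ℕ → Set ℝ := fun j ↦ S ∩ {t | ∃ q ∈ bad, |t - q| < 1 / ((j : ℝ) + 1)} with hs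
  have hsm : ∀ j, MeasurableSet (s j) := fun j ↦ hS.inter (measurableSet_near bad _)
  have hanti : Antitone s := by
    intro j j' hjj' t ht
    refine ⟨ht.1, ?_⟩
    obtain ⟨q, hq, hlt⟩ := ht.2
    refine ⟨q, hq, hlt.trans_le ?_⟩
    gcongr
  have hlim := tendsto_setIntegral_of_antitone hsm hanti ⟨0, hg.mono_set inter_subset_left⟩
  -- the intersection is contained in the finite set `bad`, so the limit integral vanishes
  have hsub : (⋂ j, s j) ⊆ (bad : Set ℝ) := by
    intro t ht
    rw [Set.mem_iInter] at ht
    by_contra htb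
    obtain ⟨q₀, hq₀, -⟩ := (ht 0).2
    have hne : (bad.image fun q ↦ |t - q|).Nonempty := ⟨_, Finset.mem_image_of_mem _ hq₀⟩
    set ρ := (bad.image fun q ↦ |t - q|).min' hne
    have hρpos : 0 < ρ := by
      obtain ⟨q, hq, hqρ⟩ := Finset.mem_image.1 ((bad.image fun q ↦ |t - q|).min'_mem hne)
      have : 0 < |t - q| := abs_pos.2 (sub_ne_zero.2 fun h ↦ htb (h ▸ hq))
      simpa only [ρ, ← hqρ] using this
    obtain ⟨j, hj⟩ := exists_nat_one_div_lt hρpos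
    obtain ⟨q, hq, hlt⟩ := (ht j).2
    have hmin : ρ ≤ |t - q| := Finset.min'_le _ _ (Finset.mem_image_of_mem _ hq)
    linarith
  have hnull : volume (⋂ j, s j) = 0 :=
    measure_mono_null hsub (bad.finite_toSet.measure_zero volume)
  rw [setIntegral_measure_zero _ hnull] at hlim
  obtain ⟨j, hj⟩ := (Metric.tendsto_nhds.1 hlim ε hε).exists
  refine ⟨1 / ((j : ℝ) + 1), by positivity, ?_⟩
  rw [Real.dist_0_eq_abs] at hj
  exact (le_abs_self _).trans hj.le

/-! ### The assembly -/

/-- **Local convergence + tightness ⇒ global convergence.** Stage-`n` masses `m n k ≥ 0`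
(`k < N n`) sit at positions `u n k ∈ [u_c, u_d]`. If (i) on every compact interval
`[s, s'] ⊆ (u_c, u_d)` avoiding the finite set `B ⊆ (u_c, u_d)` of interior bad points the mass
converges to `∫_s^{s'} g` (`g` integrable on `(u_c, u_d)`), and (ii) the mass within distance `r`
of the bad points `B ∪ {u_c, u_d}` is eventually `≤ ε` for suitable `r = r(ε) > 0`, then the total
mass converges to `∫_{(u_c, u_d)} g`. [folklore] -/
theorem tendsto_sum_of_local_of_tight {uc ud : ℝ} (hcd : uc < ud) {g : ℝ → ℝ}
    (hg : IntegrableOn g (Ioo uc ud)) (B : Finset ℝ) (hB : ∀ q ∈ B, q ∈ Ioo uc ud)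
    (N : ℕ → ℕ) (u m : ℕ → ℕ → ℝ) (hm : ∀ n k, 0 ≤ m n k)
    (hmemI : ∀ n, ∀ k < N n, u n k ∈ Icc uc ud)
    (hloc : ∀ s s', uc < s → s ≤ s' → s' < ud → (∀ q ∈ B, q ∉ Icc s s') →
      Tendsto (fun n ↦ ∑ k ∈ (range (N n)).filter (fun k ↦ u n k ∈ Icc s s'), m n k) atTop
        (𝓝 (∫ x in s..s', g x)))
    (htight : ∀ ε > 0, ∃ r > 0, ∀ᶠ n in atTop,
      ∑ k ∈ (range (N n)).filter (fun k ↦ ∃ q ∈ insert uc (insert ud B), |u n k - q| < r),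
        m n k ≤ ε) :
    Tendsto (fun n ↦ ∑ k ∈ range (N n), m n k) atTop (𝓝 (∫ x in Ioo uc ud, g x)) := by
  classical
  set bad := insert uc (insert ud B) with hbad
  have huc : uc ∈ bad := Finset.mem_insert_self _ _
  have hud : ud ∈ bad := Finset.mem_insert_of_mem (Finset.mem_insert_self _ _)
  have hbadI : ∀ q ∈ bad, q ∈ Icc uc ud := by
    intro q hq
    rcases Finset.mem_insert.1 hq with rfl | hq
    · exact left_mem_Icc.2 hcd.le
    rcases Finset.mem_insert.1 hq with rfl | hq
    · exact right_mem_Icc.2 hcd.le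
    · exact Ioo_subset_Icc_self (hB q hq)
  set P := (bad ×ˢ bad).filter
    (fun xy : ℝ × ℝ ↦ xy.1 < xy.2 ∧ ∀ q ∈ bad, ¬(xy.1 < q ∧ q < xy.2)) with hP
  have hPmem : ∀ {xy : ℝ × ℝ}, xy ∈ P ↔ xy.1 ∈ bad ∧ xy.2 ∈ bad ∧ xy.1 < xy.2 ∧
      ∀ q ∈ bad, ¬(xy.1 < q ∧ q < xy.2) := by
    intro xy; simp [hP, Finset.mem_product, and_assoc]
  rw [Metric.tendsto_atTop]
  intro ε hε
  set e := ε / 4 with he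
  have he0 : 0 < e := by positivity
  -- (1) the integral of `|g|` near the bad points is small
  obtain ⟨r₁, hr₁, hτ⟩ := exists_setIntegral_near_le bad measurableSet_Ioo hg.abs he0
  -- (2) tightness radius
  obtain ⟨r₂, hr₂, htn⟩ := htight e he0
  set r := min r₁ r₂ with hr
  have hr0 : 0 < r := lt_min hr₁ hr₂
  set P' := P.filter (fun xy : ℝ × ℝ ↦ xy.1 + r ≤ xy.2 - r) with hP'
  have hP'mem : ∀ {xy : ℝ × ℝ}, xy ∈ P' ↔ xy ∈ P ∧ xy.1 + r ≤ xy.2 - r := by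
    intro xy; simp [hP']
  -- good intervals are inside `(uc, ud)` and avoid `B`
  have hgood : ∀ xy ∈ P', uc < xy.1 + r ∧ xy.2 - r < ud ∧ ∀ q ∈ B, q ∉ Icc (xy.1 + r) (xy.2 - r) := by
    intro xy hxy
    obtain ⟨hxyP, -⟩ := hP'mem.1 hxy
    obtain ⟨hx, hy, -, hcons⟩ := hPmem.1 hxyP
    refine ⟨by linarith [(hbadI _ hx).1], by linarith [(hbadI _ hy).2], fun q hq hqI ↦ ?_⟩
    have := le_abs_sub_of_mem_Icc_consecutive hcons hqI
      (Finset.mem_insert_of_mem (Finset.mem_insert_of_mem hq))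
    simp at this
    linarith
  -- (3) local convergence on the finitely many good intervals
  have hloc' : ∀ᶠ n in atTop, ∀ xy ∈ P',
      |∑ k ∈ (range (N n)).filter (fun k ↦ u n k ∈ Icc (xy.1 + r) (xy.2 - r)), m n k -
        ∫ x in (xy.1 + r)..(xy.2 - r), g x| < e / (P'.card + 1) := by
    refine (Finset.eventually_all P').2 fun xy hxy ↦ ?_
    obtain ⟨h1, h2, h3⟩ := hgood xy hxy
    have hlim := hloc (xy.1 + r) (xy.2 - r) h1 (hP'mem.1 hxy).2 h2 h3
    refine ((Metric.tendsto_nhds.1 hlim) (e / (P'.card + 1)) (by positivity)).mono fun n hn ↦ ?_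
    rwa [Real.dist_eq] at hn
  obtain ⟨N₀, hN₀⟩ := eventually_atTop.1 (htn.and hloc')
  refine ⟨N₀, fun n hn ↦ ?_⟩
  obtain ⟨hn1, hn2⟩ := hN₀ n hn
  -- abbreviations at stage `n`
  set near : ℕ → Prop := fun k ↦ ∃ q ∈ bad, |u n k - q| < r with hnear
  set fib : ℝ × ℝ → Finset ℕ := fun xy ↦
    (range (N n)).filter (fun k ↦ u n k ∈ Icc (xy.1 + r) (xy.2 - r)) with hfib
  -- (4) decomposition of the index set
  have hcompl : (range (N n)).filter (fun k ↦ ¬near k) = P'.biUnion fib := by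
    ext k
    simp only [Finset.mem_filter, Finset.mem_range, Finset.mem_biUnion, hfib]
    constructor
    · rintro ⟨hk, hnk⟩
      rcases exists_near_or_between_consecutive bad huc hud hr0 (hmemI n k hk) with h | h
      · exact absurd h hnk
      · obtain ⟨x, hx, y, hy, hxy, hcons, hxt, hty⟩ := h
        refine ⟨(x, y), hP'mem.2 ⟨hPmem.2 ⟨hx, hy, hxy, hcons⟩, by linarith⟩, hk, hxt, hty⟩
    · rintro ⟨xy, hxy, hk, hkI⟩
      refine ⟨hk, ?_⟩
      rintro ⟨q, hq, hlt⟩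
      obtain ⟨-, -, -, hcons⟩ := hPmem.1 (hP'mem.1 hxy).1
      have := le_abs_sub_of_mem_Icc_consecutive hcons hkI hq
      linarith
  have hdisj : (P' : Set (ℝ × ℝ)).PairwiseDisjoint fib := by
    intro xy hxy xy' hxy' hne
    rw [Function.onFun, Finset.disjoint_left]
    intro k hk hk'
    simp only [hfib, Finset.mem_filter] at hk hk'
    obtain ⟨hx, hy, -, hcons⟩ := hPmem.1 (hP'mem.1 hxy).1
    obtain ⟨hx', hy', -, hcons'⟩ := hPmem.1 (hP'mem.1 hxy').1
    have hd := disjoint_Icc_consecutive hr0 hx hy hx' hy' hcons hcons' (by simpa using hne)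
    exact Set.disjoint_left.1 hd hk.2 hk'.2
  have hsum : ∑ k ∈ range (N n), m n k =
      ∑ k ∈ (range (N n)).filter near, m n k + ∑ xy ∈ P', ∑ k ∈ fib xy, m n k := by
    rw [← Finset.sum_filter_add_sum_filter_not (range (N n)) near, hcompl, Finset.sum_biUnion hdisj]
  -- (5) decomposition of the integral
  set G : Set ℝ := ⋃ xy ∈ P', Icc (xy.1 + r) (xy.2 - r) with hG
  have hGmeas : MeasurableSet G := Finset.measurableSet_biUnion _ fun _ _ ↦ measurableSet_Icc
  have hIccsub : ∀ xy ∈ P', Icc (xy.1 + r) (xy.2 - r) ⊆ Ioo uc ud := fun xy hxy t ht ↦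
    ⟨(hgood xy hxy).1.trans_le ht.1, ht.2.trans_lt (hgood xy hxy).2.1⟩
  have hGsub : G ⊆ Ioo uc ud := Set.iUnion₂_subset hIccsub
  have hint : ∫ x in Ioo uc ud, g x =
      ∑ xy ∈ P', (∫ x in (xy.1 + r)..(xy.2 - r), g x) + ∫ x in Ioo uc ud \ G, g x := by
    rw [← integral_inter_add_sdiff hGmeas hg, Set.inter_eq_right.2 hGsub]
    congr 1
    rw [integral_biUnion_finset P' (fun _ _ ↦ measurableSet_Icc) ?_
      (fun xy hxy ↦ hg.mono_set (hIccsub xy hxy))]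
    · refine Finset.sum_congr rfl fun xy hxy ↦ ?_
      rw [intervalIntegral.integral_of_le (hP'mem.1 hxy).2, integral_Icc_eq_integral_Ioc]
    · intro xy hxy xy' hxy' hne
      obtain ⟨hx, hy, -, hcons⟩ := hPmem.1 (hP'mem.1 hxy).1
      obtain ⟨hx', hy', -, hcons'⟩ := hPmem.1 (hP'mem.1 hxy').1
      exact disjoint_Icc_consecutive hr0 hx hy hx' hy' hcons hcons' (by simpa using hne)
  -- (6) the tail of the integral is small
  have hgabs : IntegrableOn (fun t ↦ |g t|) (Ioo uc ud) := hg.abs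
  have htail : |∫ x in Ioo uc ud \ G, g x| ≤ e := by
    refine (abs_integral_le_integral_abs).trans ((setIntegral_mono_set (hgabs.mono_set
      inter_subset_left) ?_ (LE.le.eventuallyLE ?_)).trans hτ)
    · exact Eventually.of_forall fun t ↦ abs_nonneg _
    · rintro t ⟨ht, htG⟩
      refine ⟨ht, show ∃ q ∈ bad, |t - q| < r₁ from ?_⟩
      rcases exists_near_or_between_consecutive bad huc hud hr0 (Ioo_subset_Icc_self ht) with h | h
      · obtain ⟨q, hq, hlt⟩ := h
        exact ⟨q, hq, hlt.trans_le (min_le_left _ _)⟩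
      · obtain ⟨x, hx, y, hy, hxy, hcons, hxt, hty⟩ := h
        have htG' : t ∈ ⋃ xy ∈ P', Icc (xy.1 + r) (xy.2 - r) :=
          Set.mem_iUnion₂.2 ⟨(x, y), hP'mem.2 ⟨hPmem.2 ⟨hx, hy, hxy, hcons⟩, by linarith⟩, hxt, hty⟩
        exact absurd htG' htG
  -- (7) the near part of the sum is small
  have hnearsum : ∑ k ∈ (range (N n)).filter near, m n k ≤ e := by
    refine (Finset.sum_le_sum_of_subset_of_nonneg ?_ fun k _ _ ↦ hm n k).trans hn1
    intro k hk
    simp only [Finset.mem_filter, hnear] at hk ⊢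
    obtain ⟨hk, q, hq, hlt⟩ := hk
    exact ⟨hk, q, hq, hlt.trans_le (min_le_right _ _)⟩
  have hnear0 : 0 ≤ ∑ k ∈ (range (N n)).filter near, m n k :=
    Finset.sum_nonneg fun k _ ↦ hm n k
  -- (8) the good part is close to the sum of the integrals
  have hgoodsum : |∑ xy ∈ P', ∑ k ∈ fib xy, m n k -
      ∑ xy ∈ P', ∫ x in (xy.1 + r)..(xy.2 - r), g x| ≤ e := by
    rw [← Finset.sum_sub_distrib]
    refine (Finset.abs_sum_le_sum_abs _ _).trans ?_
    have hle : ∀ xy ∈ P', |∑ k ∈ fib xy, m n k - ∫ x in (xy.1 + r)..(xy.2 - r), g x| ≤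
        e / (P'.card + 1) := fun xy hxy ↦ (hn2 xy hxy).le
    refine (Finset.sum_le_card_nsmul _ _ _ hle).trans ?_
    rw [nsmul_eq_mul]
    have hc : (0 : ℝ) ≤ P'.card := Nat.cast_nonneg _
    rw [mul_div_assoc']
    exact (div_le_iff₀ (by positivity)).2 (by nlinarith)
  -- (9) conclusion
  rw [Real.dist_eq, hsum, hint]
  obtain ⟨hg1, hg2⟩ := abs_le.1 hgoodsum
  obtain ⟨ht1, ht2⟩ := abs_le.1 htail
  exact abs_lt.2 ⟨by linarith, by linarith⟩

end Summit.CriticalPhenomena.CardyFormulaZ2.Theorems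

end
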